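import Mathlib
import HarnessLib
import Summits.ResolutionOfSingularities.ResolutionOfSingularities.Theorems.HomologicalConductorNoZenoOrdValuationDVR

/-!
# Route `HomologicalConductor`, crux `NoZeno`/`NoZenoR` (stmt-ResolutionOfSingularities-16483 / -19943),
# line `sandwich-cluster`: the order valuation ring on the blow-up chart, and its characterization

OURS (cell res-hironaka, crux chain W4.4, seat res-L0-w44-stub-3). Nothing here is a statement of the
manuscript under review (Hironaka 2017); AI-written, weaker than expert review.

Third companion of `HomologicalConductorNoZenoOrdValuation.lean` (`ordSet S` is a valuation subring
`V` of `K` for `S` regular local, `Frac S = K`).  For `x ∈ 𝔪_S ∖ 𝔪_S²` the chart `S[𝔪_S/x]` of the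
blow-up of the closed point consists of the quotients `a/xⁿ`, `a ∈ 𝔪_Sⁿ`; here:

* `div_pow_mem_ordSet` — `a ∈ 𝔪_Sⁿ ⇒ a/xⁿ ∈ ordSet S` (**the chart lies in `E_S`**);
* `valuation_div_pow_lt_one_iff` — `v(a/xⁿ) < 1 ↔ a ∈ 𝔪_Sⁿ⁺¹` (**the centre of `E_S` on the chart
  is the exceptional prime** `x·S[𝔪_S/x]`);
* `ordSet_subset_of_valuation_div_pow_eq_one` — a valuation ring `W ⊇ S` in which every
  `a/x^{ord a}` is a unit contains `ordSet S`; `div_pow_mem_of_forall_div_mem` (`y/x ∈ W` for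
  `y ∈ 𝔪_S` ⇒ `a/xⁿ ∈ W` for `a ∈ 𝔪_Sⁿ`);
* `coe_eq_ordSet_of_ordSet_subset` — **rank one / maximality**: `ordSet S ⊆ W ≠ K` ⇒ `↑W = ordSet S`
  (an explicit product exhibits `x⁻¹ ∈ W` otherwise);
* **`coe_eq_ordSet_of_chart_le`** — THE CHARACTERIZATION used by the S4 provers: a proper valuation
  subring `W` of `K` containing `S[𝔪_S/x]` whose centre on it lies in the exceptional prime
  (`v_W(a/xⁿ) < 1 ⇒ a ∈ 𝔪_Sⁿ⁺¹`) IS `E_S`: `↑W = ordSet S` — in the quadratic sequence of `S` along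
  `W` this is exactly the case where the sequence stops (the centre of `W` on the blown-up chart is
  the generic point of the exceptional curve, not a closed point); `chart_conditions_of_coe_eq_ordSet`
  — the converse (the conditions hold for `E_S` itself).

Everything is stated element-wise (`a/xⁿ`), so it applies verbatim to the tree's `Subring`-side
chart `Literature.AlgebraicGeometry.Resolution.blowupRing S.toSubring x` (generated by the `y/x`)
and to `Subalgebra`-side charts `Algebra.adjoin k (S ∪ 𝔪_S/x)` alike.

References: O. Zariski, P. Samuel, *Commutative Algebra* II (1960), Ch. VIII §1, Thm. 1 and Corollary,
and App. 5 [`ZariskiSamuel1960`].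
-/

noncomputable section

-- single-problem summit: the doubled namespace component `ResolutionOfSingularities` is forced
set_option linter.dupNamespace false

namespace Summit.ResolutionOfSingularities.ResolutionOfSingularities.Theorems.NoZeno.SandwichCluster

open IsLocalRing Literature.AlgebraicGeometry.Resolution

variable {k K : Type} [Field k] [Field K] [Algebra k K]
variable {S : Subalgebra k K} [IsRegularLocalRing ↥S]

/-! ## Orders of parameters and of quotients by powers of a parameter -/

/-- An element of `𝔪_S ∖ 𝔪_S²` has order one. [folklore] -/
theorem adicOrder_eq_one_of_mem_of_not_mem_sq {x : ↥S} (hx : x ∈ maximalIdeal ↥S)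
    (hx2 : x ∉ maximalIdeal ↥S ^ 2) : adicOrder x = 1 := by
  refine le_antisymm ?_ ?_
  · have h := adicOrder_le_iff x 1
    rw [Nat.cast_one] at h
    exact h.mpr hx2
  · have h := le_adicOrder_iff x 1
    rw [Nat.cast_one, pow_one] at h
    exact h.mpr hx

/-- `ord (xⁿ) = n` for `x ∈ 𝔪_S ∖ 𝔪_S²`. [folklore] -/
theorem adicOrder_pow_eq_of_mem_of_not_mem_sq {x : ↥S} (hx : x ∈ maximalIdeal ↥S)
    (hx2 : x ∉ maximalIdeal ↥S ^ 2) (n : ℕ) : adicOrder (x ^ n) = n := by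
  rw [adicOrder_pow, adicOrder_eq_one_of_mem_of_not_mem_sq hx hx2, mul_one]

/-- **The chart `S[𝔪/x]` lies in the order valuation ring**: for `x ∈ 𝔪_S ∖ 𝔪_S²` and `a ∈ 𝔪_Sⁿ`,
`a / xⁿ ∈ ordSet S`. [cite: ZariskiSamuel1960, Ch. VIII §1 Thm. 1 and Corollary] -/
theorem div_pow_mem_ordSet {x : ↥S} (hx : x ∈ maximalIdeal ↥S) (hx2 : x ∉ maximalIdeal ↥S ^ 2)
    {a : ↥S} {n : ℕ} (ha : a ∈ maximalIdeal ↥S ^ n) :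
    (a : K) / (x : K) ^ n ∈ ordSet S := by
  haveI := isDomain_of_isRegularLocalRing (↥S)
  have hx0 : x ≠ 0 := by rintro rfl; exact hx2 (zero_mem _)
  have hxn : x ^ n ≠ 0 := pow_ne_zero _ hx0
  rw [div_eq_mul_inv, ← Subalgebra.coe_pow, coe_mul_inv_mem_ordSet_iff S a (x ^ n) hxn,
    adicOrder_pow_eq_of_mem_of_not_mem_sq hx hx2]
  exact (le_adicOrder_iff a n).mpr ha

/-- **Centre of the order valuation on the chart**: for `x ∈ 𝔪_S ∖ 𝔪_S²`, `a ∈ 𝔪_Sⁿ` and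
`↑V = ordSet S`, `v(a / xⁿ) < 1 ↔ a ∈ 𝔪_Sⁿ⁺¹` — the centre of `E_S` on `S[𝔪_S/x]` is the
exceptional prime `x · S[𝔪_S/x]`. [cite: ZariskiSamuel1960, Ch. VIII §1 Thm. 1 and Corollary] -/
theorem valuation_div_pow_lt_one_iff (V : ValuationSubring K) (hV : (V : Set K) = ordSet S)
    {x : ↥S} (hx : x ∈ maximalIdeal ↥S) (hx2 : x ∉ maximalIdeal ↥S ^ 2) {a : ↥S} {n : ℕ}
    (ha : a ∈ maximalIdeal ↥S ^ n) :
    V.valuation ((a : K) / (x : K) ^ n) < 1 ↔ a ∈ maximalIdeal ↥S ^ (n + 1) := by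
  haveI := isDomain_of_isRegularLocalRing (↥S)
  have memV : ∀ {w : K}, w ∈ V ↔ w ∈ ordSet S := fun {w} => by rw [← SetLike.mem_coe, hV]
  have hx0 : x ≠ 0 := by rintro rfl; exact hx2 (zero_mem _)
  have hxK : (x : K) ≠ 0 := fun h => hx0 (by exact_mod_cast h)
  have hxn : x ^ n ≠ 0 := pow_ne_zero _ hx0
  have hmem : (a : K) / (x : K) ^ n ∈ V := memV.mpr (div_pow_mem_ordSet hx hx2 ha)
  by_cases ha0 : a = 0
  · subst ha0
    simp
  have haK : (a : K) ≠ 0 := fun h => ha0 (by exact_mod_cast h)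
  have hq0 : (a : K) / (x : K) ^ n ≠ 0 := div_ne_zero haK (pow_ne_zero _ hxK)
  -- `v(q) < 1 ↔ q⁻¹ ∉ V ↔ ¬ (ord a ≤ ord xⁿ) ↔ n + 1 ≤ ord a`
  have hle : V.valuation ((a : K) / (x : K) ^ n) ≤ 1 :=
    (ValuationSubring.valuation_le_one_iff V _).mpr hmem
  have hv0 : 0 < V.valuation ((a : K) / (x : K) ^ n) := (Valuation.pos_iff _).mpr hq0
  have hinv : ((a : K) / (x : K) ^ n)⁻¹ ∈ V ↔ 1 ≤ V.valuation ((a : K) / (x : K) ^ n) := by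
    rw [← ValuationSubring.valuation_le_one_iff, map_inv₀, inv_le_one₀ hv0]
  have hinv' : ((a : K) / (x : K) ^ n)⁻¹ ∈ V ↔ adicOrder a ≤ (n : ℕ∞) := by
    rw [inv_div, div_eq_mul_inv, ← Subalgebra.coe_pow, memV,
      coe_mul_inv_mem_ordSet_iff S (x ^ n) a ha0, adicOrder_pow_eq_of_mem_of_not_mem_sq hx hx2]
  rw [← le_adicOrder_iff, Nat.cast_add, Nat.cast_one]
  constructor
  · intro hlt
    have h1 : ¬ adicOrder a ≤ (n : ℕ∞) := fun h => (not_le.mpr hlt) (hinv.mp (hinv'.mpr h))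
    rw [not_le] at h1
    exact Order.add_one_le_of_lt h1
  · intro hge
    by_contra hnl
    rw [not_lt] at hnl
    have h1 : adicOrder a ≤ (n : ℕ∞) := hinv'.mp (hinv.mpr hnl)
    have : (n : ℕ∞) + 1 ≤ n := hge.trans h1
    exact absurd this (by
      rw [not_le]
      exact ENat.lt_add_one_iff (ENat.coe_ne_top n) |>.mpr le_rfl)

/-! ## Characterization of `E_S` among the valuation rings of `K` above `S` -/

/-- **A valuation ring above `S` in which every `a / x^{ord a}` is a unit contains `ordSet S`**
(`x ∈ 𝔪_S ∖ 𝔪_S²`): this is the case «the centre of `W` on the chart `S[𝔪_S/x]` is the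
exceptional prime». [cite: ZariskiSamuel1960, Ch. VIII §1 Thm. 1 and Corollary] -/
theorem ordSet_subset_of_valuation_div_pow_eq_one (W : ValuationSubring K)
    (hSW : S.toSubring ≤ W.toSubring) {x : ↥S} (hx : x ∈ maximalIdeal ↥S)
    (hx2 : x ∉ maximalIdeal ↥S ^ 2)
    (H : ∀ (n : ℕ) (a : ↥S), a ∈ maximalIdeal ↥S ^ n → a ∉ maximalIdeal ↥S ^ (n + 1) →
      W.valuation ((a : K) / (x : K) ^ n) = 1) :
    ordSet S ⊆ (W : Set K) := by
  haveI := isDomain_of_isRegularLocalRing (↥S)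
  have hx0 : x ≠ 0 := by rintro rfl; exact hx2 (zero_mem _)
  have hxK : (x : K) ≠ 0 := fun h => hx0 (by exact_mod_cast h)
  have hxW : (x : K) ∈ W := hSW x.property
  intro z hz
  obtain ⟨n, a, b, ha, hb, hbn, rfl⟩ := (mem_ordSet_iff_maximalIdeal S).mp hz
  have hb0 : b ≠ 0 := by rintro rfl; exact hbn (zero_mem _)
  have hbK : (b : K) ≠ 0 := fun h => hb0 (by exact_mod_cast h)
  -- `b / xⁿ` is a unit of `W`
  have hbu : W.valuation ((b : K) / (x : K) ^ n) = 1 := H n b hb hbn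
  have hbinv : ((b : K) / (x : K) ^ n)⁻¹ ∈ W := by
    rw [← ValuationSubring.valuation_le_one_iff, map_inv₀, hbu, inv_one]
  -- `a / xⁿ ∈ W`: `a = 0`, or `a` has exact order `m ≥ n` and `a/xⁿ = (a/x^m) x^(m-n)`
  have haW : (a : K) / (x : K) ^ n ∈ W := by
    by_cases ha0 : a = 0
    · subst ha0; simp
    obtain ⟨m, hm⟩ := ENat.ne_top_iff_exists.mp (adicOrder_ne_top ha0)
    have ham : a ∈ maximalIdeal ↥S ^ m := (le_adicOrder_iff a m).mp hm.le
    have ham' : a ∉ maximalIdeal ↥S ^ (m + 1) := (adicOrder_le_iff a m).mp hm.symm.le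
    have hnm : n ≤ m := by
      have := (le_adicOrder_iff a n).mpr ha
      rw [← hm] at this
      exact_mod_cast this
    have hau : W.valuation ((a : K) / (x : K) ^ m) = 1 := H m a ham ham'
    have haW' : (a : K) / (x : K) ^ m ∈ W := (ValuationSubring.valuation_le_one_iff W _).mp hau.le
    have hxm : (x : K) ^ m = (x : K) ^ n * (x : K) ^ (m - n) := by
      rw [← pow_add, Nat.add_sub_cancel' hnm]
    have : (a : K) / (x : K) ^ n = (a : K) / (x : K) ^ m * (x : K) ^ (m - n) := by
      rw [hxm]
      field_simp
    rw [this]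
    exact mul_mem haW' (pow_mem hxW _)
  have : (a : K) * ((b : K))⁻¹ = (a : K) / (x : K) ^ n * ((b : K) / (x : K) ^ n)⁻¹ := by
    field_simp
  rw [this]
  exact mul_mem haW hbinv

/-- **Rank one / maximality of `E_S`**: a proper valuation subring of `K` containing `ordSet S`
(`S` regular local, not a field, `Frac S = K`) IS the order valuation ring.  Proof: if `w ∈ W`
with `w⁻¹ = a/b`, `ord a > ord b`, then `x⁻¹ = w · (a xⁿ)/(b xᵐ) · x^(m-n-1)` lies in `W`
(`n = ord b`, `m = ord a`), whence every `d⁻¹`, `0 ≠ d ∈ S`, lies in `W` and `W = K`.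
[cite: ZariskiSamuel1960, Ch. VIII §1 Thm. 1 and Corollary] -/
theorem coe_eq_ordSet_of_ordSet_subset [IsFractionRing ↥S K] (W : ValuationSubring K)
    (hVW : ordSet S ⊆ (W : Set K)) (hW : W ≠ ⊤) (h𝔪 : maximalIdeal ↥S ≠ ⊥) :
    (W : Set K) = ordSet S := by
  haveI := isDomain_of_isRegularLocalRing (↥S)
  refine Set.Subset.antisymm ?_ hVW
  have memW : ∀ {w : K}, w ∈ ordSet S → w ∈ W := fun {w} hw => by
    have := hVW hw; exact this
  -- an element of order one
  obtain ⟨x, hx, hx2⟩ := exists_mem_maximalIdeal_not_mem_sq h𝔪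
  have hx0 : x ≠ 0 := by rintro rfl; exact hx2 (zero_mem _)
  have hxK : (x : K) ≠ 0 := fun h => hx0 (by exact_mod_cast h)
  have hordx : ∀ r : ℕ, adicOrder (x ^ r) = r := adicOrder_pow_eq_of_mem_of_not_mem_sq hx hx2
  -- if `x⁻¹ ∈ W` then `W = K`
  have key : ((x : K))⁻¹ ∈ W → False := by
    intro hxinv
    apply hW
    refine top_unique fun z _ => ?_
    obtain ⟨c, d, hd, rfl⟩ := IsFractionRing.div_surjective (A := ↥S) z
    have hd0 : d ≠ 0 := nonZeroDivisors.ne_zero hd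
    obtain ⟨r, hr⟩ := ENat.ne_top_iff_exists.mp (adicOrder_ne_top hd0)
    have h1 : ((x ^ r : ↥S) : K) * ((d : K))⁻¹ ∈ W := by
      apply memW
      rw [coe_mul_inv_mem_ordSet_iff S (x ^ r) d hd0, hordx r, hr]
    have hdK : (d : K) ≠ 0 := fun h => hd0 (by exact_mod_cast h)
    have h2 : ((d : K))⁻¹ = ((x ^ r : ↥S) : K) * ((d : K))⁻¹ * (((x : K))⁻¹) ^ r := by
      push_cast
      rw [inv_pow, mul_right_comm, mul_inv_cancel₀ (pow_ne_zero _ hxK), one_mul]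
    have hdinv : ((d : K))⁻¹ ∈ W := by
      rw [h2]; exact mul_mem h1 (pow_mem hxinv r)
    rw [div_eq_mul_inv]
    exact mul_mem (memW (coe_mem_ordSet S c)) hdinv
  intro w hw
  by_contra hwV
  have hw0 : w ≠ 0 := by rintro rfl; exact hwV (zero_mem_ordSet S)
  have hwinv : w⁻¹ ∈ ordSet S := (mem_ordSet_or_inv_mem S w).resolve_left hwV
  obtain ⟨a, b, hb0, hle, hwe⟩ := (mem_ordSet_iff S).mp hwinv
  have hbK : (b : K) ≠ 0 := fun h => hb0 (by exact_mod_cast h)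
  have ha0 : a ≠ 0 := by
    rintro rfl
    apply inv_ne_zero hw0
    rw [hwe]; simp
  have haK : (a : K) ≠ 0 := fun h => ha0 (by exact_mod_cast h)
  have hweq : w = (b : K) * ((a : K))⁻¹ := by
    rw [← inv_inv w, hwe, mul_inv, inv_inv, mul_comm]
  -- `w ∉ ordSet S` forces `ord b < ord a`
  have hlt : adicOrder b < adicOrder a := by
    rw [hweq] at hwV
    rw [coe_mul_inv_mem_ordSet_iff S b a ha0] at hwV
    exact not_le.mp hwV
  obtain ⟨n, hn⟩ := ENat.ne_top_iff_exists.mp (adicOrder_ne_top hb0)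
  obtain ⟨m, hm⟩ := ENat.ne_top_iff_exists.mp (adicOrder_ne_top ha0)
  have hnm : n < m := by rw [← hn, ← hm] at hlt; exact_mod_cast hlt
  -- `u = (a xⁿ)/(b xᵐ)` is a unit of `E_S`, so lies in `W`
  have hu : ((a * x ^ n : ↥S) : K) * (((b * x ^ m : ↥S) : K))⁻¹ ∈ W := by
    apply memW
    rw [coe_mul_inv_mem_ordSet_iff S _ _ (mul_ne_zero hb0 (pow_ne_zero _ hx0)), adicOrder_mul,
      adicOrder_mul, hordx, hordx, ← hn, ← hm]
    exact le_of_eq (by norm_cast; omega)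
  -- the explicit product giving `x⁻¹`
  obtain ⟨e, he⟩ : ∃ e : ℕ, m = n + e + 1 := ⟨m - n - 1, by omega⟩
  subst he
  have hprod : ((x : K))⁻¹ =
      w * (((a * x ^ n : ↥S) : K) * (((b * x ^ (n + e + 1) : ↥S) : K))⁻¹) * (x : K) ^ e := by
    rw [hweq]
    push_cast
    rw [pow_add, pow_add, pow_one]
    field_simp
  apply key
  rw [hprod]
  exact mul_mem (mul_mem hw hu) (pow_mem (memW (coe_mem_ordSet S x)) _)

/-- From the degree-one chart condition to all degrees: if `y/x ∈ W` for every `y ∈ 𝔪_S` then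
`a/xⁿ ∈ W` for every `a ∈ 𝔪_Sⁿ` (`𝔪ⁿ⁺¹ = 𝔪ⁿ·𝔪`). [folklore] -/
theorem div_pow_mem_of_forall_div_mem (W : ValuationSubring K) (hSW : S.toSubring ≤ W.toSubring)
    {x : ↥S} (hchart : ∀ y : ↥S, y ∈ maximalIdeal ↥S → (y : K) / (x : K) ∈ W) :
    ∀ (n : ℕ) (a : ↥S), a ∈ maximalIdeal ↥S ^ n → (a : K) / (x : K) ^ n ∈ W := by
  intro n
  induction n with
  | zero =>
    intro a _
    rw [pow_zero, div_one]
    exact hSW a.property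
  | succ n ih =>
    intro a ha
    rw [pow_succ] at ha
    refine Submodule.mul_induction_on ha ?_ ?_
    · intro b hb c hc
      have : ((b * c : ↥S) : K) / (x : K) ^ (n + 1) = (b : K) / (x : K) ^ n * ((c : K) / (x : K)) := by
        rw [Subalgebra.coe_mul, pow_succ, div_mul_div_comm]
      rw [this]
      exact mul_mem (ih b hb) (hchart c hc)
    · intro b c hb hc
      rw [Subalgebra.coe_add, add_div]
      exact add_mem hb hc

/-- **Characterization of `E_S`** (packaged for the provers of S4): a proper valuation subring `W`
of `K` containing the chart `S[𝔪_S/x]` (`x ∈ 𝔪_S ∖ 𝔪_S²`) and whose centre on it lies in the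
exceptional prime — `v_W(a/xⁿ) < 1 ⇒ a ∈ 𝔪_Sⁿ⁺¹` for `a ∈ 𝔪_Sⁿ` — IS the order valuation ring:
`↑W = ordSet S`.  (In the quadratic sequence of `S` along `W` this is the case where the sequence
STOPS: the centre of `W` on the blow-up chart is not a closed point.)
[cite: ZariskiSamuel1960, Ch. VIII §1 Thm. 1 and Corollary] -/
theorem coe_eq_ordSet_of_chart_le [IsFractionRing ↥S K] (W : ValuationSubring K) (hW : W ≠ ⊤)
    (hSW : S.toSubring ≤ W.toSubring) {x : ↥S} (hx : x ∈ maximalIdeal ↥S)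
    (hx2 : x ∉ maximalIdeal ↥S ^ 2)
    (hchart : ∀ y : ↥S, y ∈ maximalIdeal ↥S → (y : K) / (x : K) ∈ W)
    (hcen : ∀ (n : ℕ) (a : ↥S), a ∈ maximalIdeal ↥S ^ n →
      W.valuation ((a : K) / (x : K) ^ n) < 1 → a ∈ maximalIdeal ↥S ^ (n + 1)) :
    (W : Set K) = ordSet S := by
  have h𝔪 : maximalIdeal ↥S ≠ ⊥ := by
    intro h
    rw [h] at hx
    have hx0 : x = 0 := hx
    exact hx2 (hx0 ▸ zero_mem _)
  refine coe_eq_ordSet_of_ordSet_subset W ?_ hW h𝔪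
  refine ordSet_subset_of_valuation_div_pow_eq_one W hSW hx hx2 fun n a ha ha' => ?_
  have hmem : (a : K) / (x : K) ^ n ∈ W := div_pow_mem_of_forall_div_mem W hSW hchart n a ha
  have hle : W.valuation ((a : K) / (x : K) ^ n) ≤ 1 :=
    (ValuationSubring.valuation_le_one_iff W _).mpr hmem
  rcases hle.lt_or_eq with hlt | heq
  · exact absurd (hcen n a ha hlt) ha'
  · exact heq

/-- The order valuation ring itself satisfies the chart conditions of `coe_eq_ordSet_of_chart_le`
(so the characterization is an equivalence). [cite: ZariskiSamuel1960, Ch. VIII §1 Thm. 1 and Corollary] -/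
theorem chart_conditions_of_coe_eq_ordSet (V : ValuationSubring K) (hV : (V : Set K) = ordSet S)
    {x : ↥S} (hx : x ∈ maximalIdeal ↥S) (hx2 : x ∉ maximalIdeal ↥S ^ 2) :
    (∀ y : ↥S, y ∈ maximalIdeal ↥S → (y : K) / (x : K) ∈ V) ∧
      ∀ (n : ℕ) (a : ↥S), a ∈ maximalIdeal ↥S ^ n →
        V.valuation ((a : K) / (x : K) ^ n) < 1 → a ∈ maximalIdeal ↥S ^ (n + 1) := by
  have memV : ∀ {w : K}, w ∈ V ↔ w ∈ ordSet S := fun {w} => by rw [← SetLike.mem_coe, hV]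
  refine ⟨fun y hy => ?_, fun n a ha hlt => (valuation_div_pow_lt_one_iff V hV hx hx2 ha).mp hlt⟩
  have := div_pow_mem_ordSet hx hx2 (n := 1) (a := y) (by rwa [pow_one])
  rw [pow_one] at this
  exact memV.mpr this


end Summit.ResolutionOfSingularities.ResolutionOfSingularities.Theorems.NoZeno.SandwichCluster

end
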